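import Summits.Parity.BatemanHorn.Theorems.SoloInformedBatemanHornLocalisation

/-!
# SoloInformedMidWindowCancellation — Möbius cancellation over the mid-size divisors of `F(n)` is unconditional

Solo unit `solo-Parity-informed` (ideation tier, informed mode), session 20; `PLAN.md` §28, CLAIMS C96.

**Theorem (unconditional, every system; `midWindow_moebiusLogPow_isLittleO`).**  Let
`f : ι → ℤ[X]` be a Bateman–Horn system of `k ≥ 1` polynomials, `F = ∏ fᵢ`, and let `y₁ ≤ y₂` be
two cuts with `y₁(x) → ∞` and `y₂ log^{2k-1} y₂ = o(x)` (for instance `y₁ = ⌊x^{1-ε₂}⌋`,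
`y₂ = ⌊x^{1-ε₁}⌋` with `0 < ε₁ ≤ ε₂ < 1`, `midWindow_twoRpowCuts_isLittleO`).  Then

  `∑_{n ≤ x} ∑_{e ∣ F(n), y₁(x) < e ≤ y₂(x)} μ(e) logᵏ e = o(x)`.

So, on the single family of sums `W(x; I) := ∑_{n ≤ x} ∑_{e ∣ F(n), e ∈ I} μ(e) logᵏ e`, the
programme's sharpest statement reads as a dichotomy at the exponent `1`:

* for every window `I = (x^{a}, x^{b}]` with `0 < a ≤ b < 1`, `W(x; I) = o(x)` is a THEOREM for
  every Bateman–Horn system (`forall_midWindow_isLittleO`, this file) — although the unsigned sum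
  `∑_{n ≤ x} ∑_{e ∣ F(n), e ∈ I} logᵏ e` is of order `x (log x)^{2k}` by Mertens-type estimates for
  `ω_f` (not formalised here), i.e. the Möbius sign cancels a full power `(log x)^{2k}`;
* for the last window `I = (x^{1-ε}, ∞)`, `W(x; I) = o(x)` for every system is EQUIVALENT to the
  Bateman–Horn conjecture (`batemanHornConjecture_iff_forall_tail_isLittleO`,
  `SoloInformedBatemanHornLocalisation`).

Mathematically the first bullet is the convergence of the singular-series moments
`M_k(y) = ∑_{e ≤ y} μ(e) ω_f(e) logᵏ e / e` (prime-ideal-theorem strength, `SoloInformedMoebiusLogMomentLimit`)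
combined with the trivial level of distribution `x^{1-ε}` of `n ↦ F(n) mod e`; formally it is the
difference of two instances of `psiK_sub_main_sub_tail_isLittleO`.  No new arithmetic input: this file
records where the unconditional range ends, in the same coordinates as the conjecture.
-/

namespace Summit.Parity.BatemanHorn.Theorems

open Finset Filter ArithmeticFunction Asymptotics Polynomial
open scoped Topology Nat ArithmeticFunction.Moebius
open Literature.NumberTheory.Sieve (IsBatemanHornSystem batemanHornConst generalizedVonMangoldt)

variable {ι : Type*} [Fintype ι]

/-- If `y₁ ≤ y₂` pointwise, the admissibility condition `y log^A y = o(x)` passes from `y₂` to `y₁`. -/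
theorem cut_mul_log_pow_isLittleO_of_le {y₁ y₂ : ℕ → ℕ} (hle : ∀ x, y₁ x ≤ y₂ x) (A : ℕ)
    (hy₂ : (fun x : ℕ => (y₂ x : ℝ) * Real.log (y₂ x) ^ A) =o[atTop] fun x : ℕ => (x : ℝ)) :
    (fun x : ℕ => (y₁ x : ℝ) * Real.log (y₁ x) ^ A) =o[atTop] fun x : ℕ => (x : ℝ) := by
  refine IsBigO.trans_isLittleO ?_ hy₂
  refine IsBigO.of_bound 1 (Eventually.of_forall fun x => ?_)
  have h0 : 0 ≤ Real.log (y₁ x : ℝ) := Real.log_natCast_nonneg _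
  have h0' : 0 ≤ Real.log (y₂ x : ℝ) := Real.log_natCast_nonneg _
  have hlog : Real.log (y₁ x : ℝ) ≤ Real.log (y₂ x : ℝ) := by
    rcases Nat.eq_zero_or_pos (y₁ x) with h | h
    · rw [h, Nat.cast_zero, Real.log_zero]; exact h0'
    · exact Real.log_le_log (by exact_mod_cast h) (by exact_mod_cast hle x)
  rw [Real.norm_eq_abs, Real.norm_eq_abs, one_mul,
    abs_of_nonneg (mul_nonneg (Nat.cast_nonneg _) (pow_nonneg h0 A)),
    abs_of_nonneg (mul_nonneg (Nat.cast_nonneg _) (pow_nonneg h0' A))]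
  exact mul_le_mul (by exact_mod_cast hle x) (pow_le_pow_left₀ h0 hlog A) (pow_nonneg h0 A)
    (Nat.cast_nonneg _)

/-- **Unconditional Möbius cancellation over the mid-size divisors of `F(n)`.**  For a Bateman–Horn
system `f` of `k ≥ 1` polynomials, `F = ∏ fᵢ`, and cuts `y₁ ≤ y₂` with `y₁ → ∞` and
`y₂ log^{2k-1} y₂ = o(x)`:  `∑_{n ≤ x} ∑_{e ∣ F(n), y₁(x) < e ≤ y₂(x)} μ(e) logᵏ e = o(x)`. -/
theorem midWindow_moebiusLogPow_isLittleO {f : ι → ℤ[X]} (hf : IsBatemanHornSystem f)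
    (hk : 0 < Fintype.card ι) {y₁ y₂ : ℕ → ℕ} (hle : ∀ x, y₁ x ≤ y₂ x)
    (hy₁ : Tendsto y₁ atTop atTop)
    (hy₂ : (fun x : ℕ => (y₂ x : ℝ) * Real.log (y₂ x) ^ (Fintype.card ι - 1 + Fintype.card ι))
      =o[atTop] fun x : ℕ => (x : ℝ)) :
    (fun x : ℕ => ∑ n ∈ Icc 1 x,
        ∑ e ∈ (((∏ i, f i).eval (n : ℤ)).natAbs).divisors with (y₁ x < e ∧ e ≤ y₂ x),
          (μ e : ℝ) * Real.log e ^ Fintype.card ι) =o[atTop] fun x : ℕ => (x : ℝ) := by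
  have hy₂t : Tendsto y₂ atTop atTop := tendsto_atTop_mono hle hy₁
  have hy₁' := cut_mul_log_pow_isLittleO_of_le hle _ hy₂
  have h1 := psiK_sub_main_sub_tail_isLittleO hf hk hy₁ hy₁'
  have h2 := psiK_sub_main_sub_tail_isLittleO hf hk hy₂t hy₂
  have hc : ((-1 : ℝ) ^ Fintype.card ι) ≠ 0 := pow_ne_zero _ (by norm_num)
  -- `E(y₂) - E(y₁) = (-1)^k (T(y₁) - T(y₂)) = o(x)`
  have h3 : (fun x : ℕ => (-1 : ℝ) ^ Fintype.card ι *
      (∑ n ∈ Icc 1 x, ∑ e ∈ (((∏ i, f i).eval (n : ℤ)).natAbs).divisors with y₁ x < e,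
          (μ e : ℝ) * Real.log e ^ Fintype.card ι
        - ∑ n ∈ Icc 1 x, ∑ e ∈ (((∏ i, f i).eval (n : ℤ)).natAbs).divisors with y₂ x < e,
          (μ e : ℝ) * Real.log e ^ Fintype.card ι)) =o[atTop] fun x : ℕ => (x : ℝ) := by
    refine (h2.sub h1).congr_left fun x => ?_
    ring
  refine ((isLittleO_const_mul_left_iff hc).mp h3).congr_left fun x => ?_
  rw [← sum_sub_distrib]
  refine sum_congr rfl fun n _ => ?_
  rw [sum_filter, sum_filter, sum_filter, ← sum_sub_distrib]
  refine sum_congr rfl fun e _ => ?_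
  have hx := hle x
  split_ifs <;> first | (exfalso; omega) | simp

/-- The window `(y₁(x), x^{1-ε}]` for any `y₁ → ∞` below the standard cut. -/
theorem midWindow_rpowCut_isLittleO {f : ι → ℤ[X]} (hf : IsBatemanHornSystem f)
    (hk : 0 < Fintype.card ι) {ε : ℝ} (hε : 0 < ε) (hε1 : ε < 1) {y₁ : ℕ → ℕ}
    (hy₁ : Tendsto y₁ atTop atTop) (hle : ∀ x, y₁ x ≤ ⌊(x : ℝ) ^ (1 - ε)⌋₊) :
    (fun x : ℕ => ∑ n ∈ Icc 1 x,
        ∑ e ∈ (((∏ i, f i).eval (n : ℤ)).natAbs).divisors with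
            (y₁ x < e ∧ e ≤ ⌊(x : ℝ) ^ (1 - ε)⌋₊),
          (μ e : ℝ) * Real.log e ^ Fintype.card ι) =o[atTop] fun x : ℕ => (x : ℝ) :=
  midWindow_moebiusLogPow_isLittleO hf hk hle hy₁ (rpowCut_mul_log_pow_isLittleO hε hε1 _)

/-- The standard cuts are nested: `⌊x^{1-ε₂}⌋ ≤ ⌊x^{1-ε₁}⌋` for `ε₁ ≤ ε₂ < 1`. -/
theorem rpowCut_mono {ε₁ ε₂ : ℝ} (h : ε₁ ≤ ε₂) (hε2 : ε₂ < 1) (x : ℕ) :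
    ⌊(x : ℝ) ^ (1 - ε₂)⌋₊ ≤ ⌊(x : ℝ) ^ (1 - ε₁)⌋₊ := by
  refine Nat.floor_mono ?_
  rcases Nat.eq_zero_or_pos x with hx | hx
  · subst hx
    rw [Nat.cast_zero, Real.zero_rpow (by linarith), Real.zero_rpow (by linarith)]
  · exact Real.rpow_le_rpow_of_exponent_le (by exact_mod_cast hx) (by linarith)

/-- **The window between two standard cuts.**  For `0 < ε₁ ≤ ε₂ < 1` and every Bateman–Horn system
of `k ≥ 1` polynomials: `∑_{n ≤ x} ∑_{e ∣ F(n), x^{1-ε₂} < e ≤ x^{1-ε₁}} μ(e) logᵏ e = o(x)`,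
unconditionally. -/
theorem midWindow_twoRpowCuts_isLittleO {f : ι → ℤ[X]} (hf : IsBatemanHornSystem f)
    (hk : 0 < Fintype.card ι) {ε₁ ε₂ : ℝ} (hε1 : 0 < ε₁) (h12 : ε₁ ≤ ε₂) (hε2 : ε₂ < 1) :
    (fun x : ℕ => ∑ n ∈ Icc 1 x,
        ∑ e ∈ (((∏ i, f i).eval (n : ℤ)).natAbs).divisors with
            (⌊(x : ℝ) ^ (1 - ε₂)⌋₊ < e ∧ e ≤ ⌊(x : ℝ) ^ (1 - ε₁)⌋₊),
          (μ e : ℝ) * Real.log e ^ Fintype.card ι) =o[atTop] fun x : ℕ => (x : ℝ) :=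
  midWindow_moebiusLogPow_isLittleO hf hk (rpowCut_mono h12 hε2) (tendsto_rpowCut_atTop hε2)
    (rpowCut_mul_log_pow_isLittleO hε1 (lt_of_le_of_lt h12 hε2) _)

/-- **Every window below the exponent `1`, every system** — the unconditional companion of
`batemanHornConjecture_iff_forall_tail_isLittleO`: for `0 < ε₁ ≤ ε₂ < 1` and every Bateman–Horn
system `f : Fin (k+1) → ℤ[X]`,
`∑_{n ≤ x} ∑_{e ∣ ∏ fᵢ(n), x^{1-ε₂} < e ≤ x^{1-ε₁}} μ(e) log^{k+1} e = o(x)`.  (The same statement for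
the window `e > x^{1-ε}`, for every system, is the Bateman–Horn conjecture.) -/
theorem forall_midWindow_isLittleO {ε₁ ε₂ : ℝ} (hε1 : 0 < ε₁) (h12 : ε₁ ≤ ε₂) (hε2 : ε₂ < 1)
    (k : ℕ) (f : Fin (k + 1) → ℤ[X]) (hf : IsBatemanHornSystem f) :
    (fun x : ℕ => ∑ n ∈ Icc 1 x,
        ∑ e ∈ (((∏ i, f i).eval (n : ℤ)).natAbs).divisors with
            (⌊(x : ℝ) ^ (1 - ε₂)⌋₊ < e ∧ e ≤ ⌊(x : ℝ) ^ (1 - ε₁)⌋₊),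
          (μ e : ℝ) * Real.log e ^ (k + 1)) =o[atTop] fun x : ℕ => (x : ℝ) := by
  have h := midWindow_twoRpowCuts_isLittleO hf (by simp) hε1 h12 hε2
  simpa only [Fintype.card_fin] using h

end Summit.Parity.BatemanHorn.Theorems
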